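import Literature.NumberTheory.Weil1965.AdelicFibreMeasures
import Literature.NumberTheory.Weil1965.LocalSplitFormBoxCharacterIntegral
import Literature.NumberTheory.Automorphic.AdelicVectorPlaceSplittingSchwartzBruhatSlices
import Literature.NumberTheory.Automorphic.AdelePlacesIdempotent
import Mathlib.Topology.Algebra.Module.ModuleTopology
import HarnessLib

/-!
# `E_X` does not charge the coordinate hyperplanes of a split frame at a finite place

Topic `NumberTheory/Weil1965`; namespace `Literature.NumberTheory.Weil1965`. KERNEL MATHEMATICS ONLY: proved theorems, no
definition, no named fact, no `sorry`.

Setting [Weil1965, Chap. IV n° 41 (34)–(35), Chap. V n° 50–51]: `F` a number field, `X = 𝔸_F^ι`, `h : X → 𝔸_F` continuous with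
Weil's condition (B) `hB`, `E_X` Weil's Siegel–Eisenstein measure (★ `adelicSiegelMeasure`, the positive Radon measure of the positive
functional `Ψ ↦ Σ_ξ F*_Ψ(ξ)`).  At a finite place `v` with the place splitting `X = X(F_v) × X^{(v)}` (★ `AdelicVector.placeSplitting`)
suppose `h` SPLITS, `h(single a + y) = h(single a) + h(y)` for `y` trivial at `v`, and is at `v` the SPLIT FORM of a linear frame
`β : F_v^ι ≃ F_v^κ × F_v^κ`, `h(single a) = ι_v((β a)₁ ⬝ᵥ (β a)₂)`, with `β_* μ_v^ι = c · μ_v^κ ⊗ μ_v^κ`.  THEN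

  `E_X {x | (β x_v)₁ = 0} = 0`  and  `E_X {x | (β x_v)₂ = 0} = 0`

(`adelicSiegelMeasure_frameHyperplane_eq_zero`).  PROOF (Weil's test-function argument, n° 51): for the pure tensors
`Φ_k = 𝟙[(β x_v)₁ ∈ (𝔭^k)^κ, (β x_v)₂ ∈ (𝔭^{-j})^κ] · Ψ(x^{(v)})` (★ `indicator_evalAt_mul_slice_mem_piSchwartzBruhatReal`) the
coefficients factor, `F*_{Φ_k}(ξ) = κ₀ · G_k(ξ) · A_Ψ(ξ)` (★ `exists_integral_eq_smul_integral_prod`), with the LOCAL FACTOR `G_k(ξ)` of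
★ `LocalSplitFormBoxCharacterIntegral`: `‖G_k(ξ)‖ ≤ ‖G_0(ξ)‖` and `G_k(ξ) → 0`; dominated convergence of the `ξ`-series (dominant
`Σ_ξ |F*_{Φ_0}(ξ)| < ∞` = (B)) gives `E_X(Φ_k) → 0`, while `E_X-measure(W) ≤ ∫ Φ_k dE_X ≤ E_X(Φ_k)` on
`W = {(β x_v)₁ = 0, (β x_v)₂ ∈ (𝔭^{-j})^κ, Ψ(x^{(v)}) ≥ 1}`; the `W` exhaust the hyperplane.  At the CM ∕ unitary datum
(`h = hNorm`, a rational quadratic form) the two splitting letters `hadd` ∕ `hloc` are the cell's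
`Theorems/H413E2SWSplitPlaceHNormLocal` (cross terms `ι_v(a_i) · y_j = 0`; `hNorm (single a)` is `v`-supported).

USE (cell `hodgecm-mathlib`, P4 ENGINE E-2, `StubSW2iii` identity half, pole (S-3E), socket `hS3E` of ★ (T5)
`Theorems/H413E2SWIdentityCloseFibreCMFrame`).  HC_CM is proved only modulo the printed citations until rung 0 closes.

## References
* [Weil1965] A. Weil, *Sur la formule de Siegel dans la théorie des groupes classiques*, Acta Math. 113 (1965), Chap. I n° 2
  Lemme 3 p. 7; Chap. IV n° 41 (34)–(35) p. 59; Chap. V n° 50–51 pp. 73–75.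
* [WeilBNT1967] A. Weil, *Basic Number Theory* (1967), Chap. VII §2 Prop. 2.
-/

set_option autoImplicit false

noncomputable section

namespace Literature.NumberTheory.Weil1965

open _root_.MeasureTheory _root_.Filter _root_.Set NumberField IsDedekindDomain
open Literature.NumberTheory.Automorphic Literature.NumberTheory.Automorphic.AdelicVector
open _root_.Topology
open scoped NNReal ENNReal

variable (F : Type) [Field F] [NumberField F] (ι : Type) [Fintype ι]
  [MeasurableSpace (adeleQuotient F)] [BorelSpace (adeleQuotient F)]
  [MeasurableSpace (AdeleRing (𝓞 F) F)] [BorelSpace (AdeleRing (𝓞 F) F)]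

/-! ## §1 The coefficients of a `v`-tensor factor -/

section Coeff

variable (νX : Measure (ι → AdeleRing (𝓞 F) F)) (h : (ι → AdeleRing (𝓞 F) F) → AdeleRing (𝓞 F) F)
  (v : HeightOneSpectrum (𝓞 F)) [MeasurableSpace (v.adicCompletion F)]

omit [Fintype ι] [MeasurableSpace (adeleQuotient F)] [BorelSpace (adeleQuotient F)] [BorelSpace (AdeleRing (𝓞 F) F)] in
/-- **`F*_{𝟙_A ⊗ Θ}(ξ) = κ₀ · G_A(ξ) · A_Θ(ξ)`**: along the place splitting `x = single a + y` (Haar factorisation `hsplit`, ★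
`exists_integral_eq_smul_integral_prod`) the Siegel–Eisenstein coefficient of a pure tensor `x ↦ 𝟙_A(x_v) Θ(x^{(v)})` is `κ₀` times the
LOCAL FACTOR `∫ 𝟙_A(a) ψ_v(ξ_v q(a)) dμ(a)` times `∫ ψ(ξ h(y)) Θ(y) dμ'(y)`, provided `h(single a + y) = ι_v(q a) + h(y)`.
[cite: Weil1965, Chap. V n° 51, p. 74] -/
theorem adelicSiegelCoeff_indicator_evalAt_mul_slice (μL : Measure (ι → v.adicCompletion F)) [SFinite μL]
    (μ' : Measure (trivialAt F ι v)) [SFinite μ'] {κ₀ : ℝ≥0}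
    (hsplit : ∀ G : (ι → AdeleRing (𝓞 F) F) → ℂ, ∫ x, G x ∂νX =
      (κ₀ : ℝ) • ∫ p : (ι → v.adicCompletion F) × trivialAt F ι v,
        G (single F ι v p.1 + (p.2 : ι → AdeleRing (𝓞 F) F)) ∂(μL.prod μ'))
    {q : (ι → v.adicCompletion F) → v.adicCompletion F}
    (hadd : ∀ (a : ι → v.adicCompletion F) (y : ι → AdeleRing (𝓞 F) F), y ∈ trivialAt F ι v →
      h (single F ι v a + y) = h (single F ι v a) + h y)
    (hloc : ∀ a, h (single F ι v a) = adeleSingleHom F v (q a))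
    (A : Set (ι → v.adicCompletion F)) (Θ : (ι → AdeleRing (𝓞 F) F) → ℂ) (ξ : F) :
    adelicSiegelCoeff F ι νX h (fun x => A.indicator (fun _ => (1 : ℂ)) (evalAt F ι v x) *
        Θ (placeSplitting F ι v (0, ((placeSplitting F ι v).symm x).2))) ξ =
      (κ₀ : ℂ) * (∫ a, A.indicator (fun _ => (1 : ℂ)) a *
          ((adeleAddCharAt F v (AdelicGroupData.adeleEval F v (algebraMap F (AdeleRing (𝓞 F) F) ξ) * q a) : Circle) : ℂ) ∂μL) *
        ∫ y : trivialAt F ι v, ((adeleAddChar F (algebraMap F (AdeleRing (𝓞 F) F) ξ * h y) : Circle) : ℂ) *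
          Θ (placeSplitting F ι v (0, y)) ∂μ' := by
  rw [adelicSiegelCoeff_eq, hsplit]
  have hpt : ∀ p : (ι → v.adicCompletion F) × trivialAt F ι v,
      ((adeleAddChar F (algebraMap F (AdeleRing (𝓞 F) F) ξ * h (single F ι v p.1 + (p.2 : ι → AdeleRing (𝓞 F) F))) : Circle) : ℂ) *
        (A.indicator (fun _ => (1 : ℂ)) (evalAt F ι v (single F ι v p.1 + (p.2 : ι → AdeleRing (𝓞 F) F))) *
          Θ (placeSplitting F ι v (0, ((placeSplitting F ι v).symm (single F ι v p.1 + (p.2 : ι → AdeleRing (𝓞 F) F))).2))) =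
      (A.indicator (fun _ => (1 : ℂ)) p.1 *
          ((adeleAddCharAt F v (AdelicGroupData.adeleEval F v (algebraMap F (AdeleRing (𝓞 F) F) ξ) * q p.1) : Circle) : ℂ)) *
        (((adeleAddChar F (algebraMap F (AdeleRing (𝓞 F) F) ξ * h p.2) : Circle) : ℂ) * Θ (placeSplitting F ι v (0, p.2))) := by
    rintro ⟨a, y⟩
    have e1 : evalAt F ι v (single F ι v a + (y : ι → AdeleRing (𝓞 F) F)) = a := by
      rw [map_add, evalAt_single, evalAt_eq_zero_of_mem y.2, add_zero]
    have e2 : ((placeSplitting F ι v).symm (single F ι v a + (y : ι → AdeleRing (𝓞 F) F))).2 = y := by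
      have := (placeSplitting F ι v).symm_apply_apply (a, y)
      rw [placeSplitting_apply] at this
      rw [this]
    have e3 : adeleAddChar F (algebraMap F (AdeleRing (𝓞 F) F) ξ * h (single F ι v a + (y : ι → AdeleRing (𝓞 F) F))) =
        adeleAddCharAt F v (AdelicGroupData.adeleEval F v (algebraMap F (AdeleRing (𝓞 F) F) ξ) * q a) *
          adeleAddChar F (algebraMap F (AdeleRing (𝓞 F) F) ξ * h y) := by
      rw [hadd a y y.2, hloc a, mul_add, mul_adeleSingleHom, AddChar.map_add_eq_mul, adeleAddCharAt_apply]
    simp only [e1, e2, e3, Circle.coe_mul]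
    ring
  rw [integral_congr_ae (Eventually.of_forall hpt), integral_prod_mul
    (fun a : ι → v.adicCompletion F => A.indicator (fun _ => (1 : ℂ)) a *
      ((adeleAddCharAt F v (AdelicGroupData.adeleEval F v (algebraMap F (AdeleRing (𝓞 F) F) ξ) * q a) : Circle) : ℂ))
    (fun y : trivialAt F ι v => ((adeleAddChar F (algebraMap F (AdeleRing (𝓞 F) F) ξ * h y) : Circle) : ℂ) *
      Θ (placeSplitting F ι v (0, y))), Complex.real_smul]
  ring

end Coeff

/-! ## §2 `E_X(W) ≤ E_X(Ψ)` for `Ψ ≥ 1_W`, and the test-function argument on one frame box -/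

section Null

variable (νX : Measure (ι → AdeleRing (𝓞 F) F)) [νX.IsAddHaarMeasure]
  (h : (ι → AdeleRing (𝓞 F) F) → AdeleRing (𝓞 F) F) (hh : Continuous h)
  (hB : ∀ Φ ∈ piSchwartzBruhat F ι, Summable fun ξ : F => ‖adelicSiegelCoeff F ι νX h Φ ξ‖)

/-- **`E_X`-MEASURE BOUND BY THE FUNCTIONAL**: if `0 ≤ Ψ ∈ 𝒮_ℝ(X)` is `≥ 1` on `W`, then `E_X(W) ≤ E_X(Ψ)` (as `ℝ≥0∞`; ★
`integral_adelicSiegelMeasure_le_of_nonneg`: `∫ Ψ dE_X ≤ E_X(Ψ)`). [cite: Weil1965, Chap. I n° 2, Lemme 3, p. 7] -/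
theorem adelicSiegelMeasure_le_ofReal_adelicSiegelFunctional (Ψ : piSchwartzBruhatReal F ι)
    (hΨ0 : 0 ≤ (Ψ : (ι → AdeleRing (𝓞 F) F) → ℝ)) {W : Set (ι → AdeleRing (𝓞 F) F)}
    (hW : ∀ x ∈ W, 1 ≤ (Ψ : (ι → AdeleRing (𝓞 F) F) → ℝ) x) :
    adelicSiegelMeasure F ι νX h hh hB W ≤ ENNReal.ofReal (adelicSiegelFunctional F ι νX h hh hB Ψ) := by
  haveI := secondCountableTopology_adeleRing (K := F)
  haveI : Countable ι := Finite.to_countable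
  haveI : BorelSpace (ι → AdeleRing (𝓞 F) F) := Pi.borelSpace
  obtain ⟨hint, hle⟩ := integral_adelicSiegelMeasure_le_of_nonneg hh hB Ψ hΨ0
  have hΨc : Continuous (Ψ : (ι → AdeleRing (𝓞 F) F) → ℝ) := continuous_of_mem_piSchwartzBruhatReal Ψ.2
  set S : Set (ι → AdeleRing (𝓞 F) F) := {x | 1 ≤ (Ψ : (ι → AdeleRing (𝓞 F) F) → ℝ) x} with hS
  have hSm : MeasurableSet S := (isClosed_le continuous_const hΨc).measurableSet
  calc adelicSiegelMeasure F ι νX h hh hB W ≤ adelicSiegelMeasure F ι νX h hh hB S := measure_mono fun x hx => hW x hx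
    _ = ∫⁻ x, S.indicator 1 x ∂(adelicSiegelMeasure F ι νX h hh hB) := (lintegral_indicator_one hSm).symm
    _ ≤ ∫⁻ x, ENNReal.ofReal ((Ψ : (ι → AdeleRing (𝓞 F) F) → ℝ) x) ∂(adelicSiegelMeasure F ι νX h hh hB) := by
        refine lintegral_mono fun x => ?_
        by_cases hx : x ∈ S
        · rw [indicator_of_mem hx, Pi.one_apply]
          exact ENNReal.one_le_ofReal.2 hx
        · rw [indicator_of_notMem hx]
          exact bot_le
    _ = ENNReal.ofReal (∫ x, (Ψ : (ι → AdeleRing (𝓞 F) F) → ℝ) x ∂(adelicSiegelMeasure F ι νX h hh hB)) :=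
        (ofReal_integral_eq_lintegral_ofReal hint (Eventually.of_forall hΨ0)).symm
    _ ≤ ENNReal.ofReal (adelicSiegelFunctional F ι νX h hh hB Ψ) := ENNReal.ofReal_le_ofReal hle

variable (v : HeightOneSpectrum (𝓞 F)) [MeasurableSpace (v.adicCompletion F)] [BorelSpace (v.adicCompletion F)]
  (μv : Measure (v.adicCompletion F)) [μv.IsAddHaarMeasure] {κ : Type} [Fintype κ] [Nonempty κ]
  (βv : (ι → v.adicCompletion F) ≃ₗ[v.adicCompletion F] ((κ → v.adicCompletion F) × (κ → v.adicCompletion F)))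

/-- **ONE FRAME BOX**: for `j : ℤ` and `0 ≤ Ψ ∈ 𝒮_ℝ(X)` the set `W = {(β x_v)₁ = 0, (β x_v)₂ ∈ (𝔭^j)^κ, Ψ(x − single x_v) ≥ 1}` is
`E_X`-null: the test functions `Φ_k = 𝟙_{β⁻¹((𝔭^k)^κ × (𝔭^j)^κ)}(x_v) Ψ(x^{(v)})` are `≥ 1_W`, and `E_X(Φ_k) = Re Σ_ξ F*_{Φ_k}(ξ) → 0` by
dominated convergence (`F*_{Φ_k}(ξ) = κ₀ G_k(ξ) A(ξ)`, `‖G_k‖ ≤ ‖G_0‖`, `G_k → 0`, ★ `LocalSplitFormBoxCharacterIntegral`).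
[cite: Weil1965, Chap. V n° 51, pp. 73–75] -/
theorem adelicSiegelMeasure_frameBox_eq_zero
    (hHaar : ∃ cst : ℝ≥0, 0 < cst ∧ Measure.map βv (Measure.pi fun _ : ι => μv) =
      (cst : ℝ≥0∞) • ((Measure.pi fun _ : κ => μv).prod (Measure.pi fun _ : κ => μv)))
    (hadd : ∀ (a : ι → v.adicCompletion F) (y : ι → AdeleRing (𝓞 F) F), y ∈ trivialAt F ι v →
      h (single F ι v a + y) = h (single F ι v a) + h y)
    (hloc : ∀ a, h (single F ι v a) = adeleSingleHom F v ((βv a).1 ⬝ᵥ (βv a).2))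
    (j : ℤ) {Ψ : (ι → AdeleRing (𝓞 F) F) → ℝ} (hΨ : Ψ ∈ piSchwartzBruhatReal F ι) (hΨ0 : 0 ≤ Ψ) :
    adelicSiegelMeasure F ι νX h hh hB {x | (βv (evalAt F ι v x)).1 = 0 ∧
      (βv (evalAt F ι v x)).2 ∈ piPrimePowBall (v.adicCompletion F) κ j ∧
        1 ≤ Ψ (x - single F ι v (evalAt F ι v x))} = 0 := by
  classical
  haveI := secondCountableTopology_adeleRing (K := F)
  haveI := secondCountableTopology_adicCompletion F v
  haveI : Countable ι := Finite.to_countable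
  haveI : BorelSpace (ι → AdeleRing (𝓞 F) F) := Pi.borelSpace
  haveI : BorelSpace (ι → v.adicCompletion F) := Pi.borelSpace
  haveI : BorelSpace (trivialAt F ι v) := Subtype.borelSpace _
  haveI := locallyCompactSpace_trivialAt F ι v
  haveI := secondCountableTopology_trivialAt F ι v
  haveI : IsModuleTopology (v.adicCompletion F) ((κ → v.adicCompletion F) × (κ → v.adicCompletion F)) := inferInstance
  obtain ⟨κ₀, -, hsplit⟩ := exists_integral_eq_smul_integral_prod (K := F) (ι := ι) (v := v) νX
    (Measure.pi fun _ : ι => μv) (Measure.addHaar : Measure (trivialAt F ι v)) (E := ℂ)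
  obtain ⟨cst, -, hHaar'⟩ := hHaar
  have hβc : Continuous βv := IsModuleTopology.continuous_of_linearMap βv.toLinearMap
  have hβsc : Continuous βv.symm := IsModuleTopology.continuous_of_linearMap βv.symm.toLinearMap
  have hψc : Continuous (adeleAddCharAt F v) := continuous_adeleAddCharAt F v
  -- the frame boxes `A k = β⁻¹((𝔭^k)^κ × (𝔭^j)^κ)` and the test functions `Φ_k`
  set A : ℕ → Set (ι → v.adicCompletion F) := fun k =>
    βv ⁻¹' (piPrimePowBall (v.adicCompletion F) κ (k : ℤ) ×ˢ piPrimePowBall (v.adicCompletion F) κ j) with hA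
  have hAo : ∀ k, IsOpen (A k) := fun k =>
    ((isOpen_piPrimePowBall _).prod (isOpen_piPrimePowBall _)).preimage hβc
  have hAc : ∀ k, IsCompact (A k) := fun k => by
    have : A k = βv.symm '' (piPrimePowBall (v.adicCompletion F) κ (k : ℤ) ×ˢ piPrimePowBall (v.adicCompletion F) κ j) := by
      ext a
      simp only [hA, mem_preimage, mem_image]
      constructor
      · intro ha
        exact ⟨βv a, ha, βv.symm_apply_apply a⟩
      · rintro ⟨p, hp, rfl⟩
        rwa [LinearEquiv.apply_symm_apply]
    rw [this]
    exact ((isCompact_piPrimePowBall _).prod (isCompact_piPrimePowBall _)).image hβsc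
  set Φ : ℕ → (ι → AdeleRing (𝓞 F) F) → ℝ := fun k x => (A k).indicator (fun _ => (1 : ℝ)) (evalAt F ι v x) *
    Ψ (placeSplitting F ι v (0, ((placeSplitting F ι v).symm x).2)) with hΦ
  have hΦmem : ∀ k, Φ k ∈ piSchwartzBruhatReal F ι := fun k =>
    indicator_evalAt_mul_slice_mem_piSchwartzBruhatReal hΨ 0 (hAo k) (hAc k)
  have hΦ0 : ∀ k, 0 ≤ Φ k := fun k x =>
    mul_nonneg (indicator_nonneg (fun _ _ => zero_le_one) _) (hΨ0 _)
  -- the coefficients `F*_{Φ_k}(ξ) = κ₀ · G_k(ξ) · I(ξ)`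
  set η : F → v.adicCompletion F := fun ξ => AdelicGroupData.adeleEval F v (algebraMap F (AdeleRing (𝓞 F) F) ξ) with hη
  set G : ℕ → F → ℂ := fun k ξ => ∫ a, (A k).indicator (fun _ => (1 : ℂ)) a *
    ((adeleAddCharAt F v (η ξ * ((βv a).1 ⬝ᵥ (βv a).2)) : Circle) : ℂ) ∂(Measure.pi fun _ : ι => μv) with hG
  set I : F → ℂ := fun ξ => ∫ y : trivialAt F ι v, ((adeleAddChar F (algebraMap F (AdeleRing (𝓞 F) F) ξ * h y) : Circle) : ℂ) *
    (Ψ (placeSplitting F ι v (0, y)) : ℂ) ∂(Measure.addHaar : Measure (trivialAt F ι v)) with hI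
  have hcoef : ∀ k ξ, adelicSiegelCoeff F ι νX h (fun x => ((Φ k x : ℝ) : ℂ)) ξ = (κ₀ : ℂ) * G k ξ * I ξ := by
    intro k ξ
    have hcast : (fun x => ((Φ k x : ℝ) : ℂ)) = fun x => (A k).indicator (fun _ => (1 : ℂ)) (evalAt F ι v x) *
        (fun z => (Ψ z : ℂ)) (placeSplitting F ι v (0, ((placeSplitting F ι v).symm x).2)) := by
      funext x
      simp only [hΦ, Complex.ofReal_mul]
      by_cases hx : evalAt F ι v x ∈ A k
      · rw [indicator_of_mem hx, indicator_of_mem hx, Complex.ofReal_one]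
      · rw [indicator_of_notMem hx, indicator_of_notMem hx, Complex.ofReal_zero]
    rw [hcast]
    exact adelicSiegelCoeff_indicator_evalAt_mul_slice F ι νX h v (Measure.pi fun _ : ι => μv) Measure.addHaar hsplit
      hadd hloc (A k) (fun z => (Ψ z : ℂ)) ξ
  -- domination `‖F*_{Φ_k}(ξ)‖ ≤ ‖F*_{Φ_0}(ξ)‖` and limit `F*_{Φ_k}(ξ) → 0`
  have hdom : ∀ k ξ, ‖adelicSiegelCoeff F ι νX h (fun x => ((Φ k x : ℝ) : ℂ)) ξ‖ ≤
      ‖adelicSiegelCoeff F ι νX h (fun x => ((Φ 0 x : ℝ) : ℂ)) ξ‖ := by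
    intro k ξ
    rw [hcoef, hcoef, norm_mul, norm_mul, norm_mul, norm_mul]
    refine mul_le_mul_of_nonneg_right (mul_le_mul_of_nonneg_left ?_ (norm_nonneg _)) (norm_nonneg _)
    have hmono := norm_integral_indicator_preimage_frame_mul_coe_addChar_mono μv (adeleAddCharAt F v) hψc βv hHaar'
      (η ξ) (measurableSet_piPrimePowBall (k : ℤ)) (measurableSet_piPrimePowBall ((0 : ℕ) : ℤ))
      (piPrimePowBall_antitone (by exact_mod_cast Nat.zero_le k)) (measure_piPrimePowBall_lt_top _ _).ne j
    simpa only [hG, hA] using hmono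
  have hlim : ∀ ξ, Tendsto (fun k => adelicSiegelCoeff F ι νX h (fun x => ((Φ k x : ℝ) : ℂ)) ξ) atTop (𝓝 0) := by
    intro ξ
    simp only [hcoef]
    have ht := tendsto_integral_indicator_preimage_frame_mul_coe_addChar μv (adeleAddCharAt F v) hψc βv hHaar' (η ξ) j
    have := (ht.const_mul (κ₀ : ℂ)).mul_const (I ξ)
    simpa only [hG, hA, mul_zero, zero_mul] using this
  have hsum : Summable fun ξ : F => ‖adelicSiegelCoeff F ι νX h (fun x => ((Φ 0 x : ℝ) : ℂ)) ξ‖ :=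
    hB _ (mem_piSchwartzBruhatReal_iff.1 (hΦmem 0))
  have htsum : Tendsto (fun k => ∑' ξ : F, adelicSiegelCoeff F ι νX h (fun x => ((Φ k x : ℝ) : ℂ)) ξ) atTop (𝓝 0) := by
    have := tendsto_tsum_of_dominated_convergence (𝓕 := atTop) hsum hlim (Eventually.of_forall fun k ξ => hdom k ξ)
    simpa only [tsum_zero] using this
  have hE : Tendsto (fun k => adelicSiegelFunctional F ι νX h hh hB ⟨Φ k, hΦmem k⟩) atTop (𝓝 0) := by
    have := (Complex.continuous_re.tendsto 0).comp htsum
    simpa only [adelicSiegelFunctional_apply, Complex.zero_re, Function.comp_def] using this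
  -- the bound `E_X(W) ≤ E_X(Φ_k)` for every `k`
  have hbound : ∀ k, adelicSiegelMeasure F ι νX h hh hB {x | (βv (evalAt F ι v x)).1 = 0 ∧
      (βv (evalAt F ι v x)).2 ∈ piPrimePowBall (v.adicCompletion F) κ j ∧ 1 ≤ Ψ (x - single F ι v (evalAt F ι v x))} ≤
      ENNReal.ofReal (adelicSiegelFunctional F ι νX h hh hB ⟨Φ k, hΦmem k⟩) := by
    intro k
    refine adelicSiegelMeasure_le_ofReal_adelicSiegelFunctional F ι νX h hh hB ⟨Φ k, hΦmem k⟩ (hΦ0 k) fun x hx => ?_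
    obtain ⟨h1, h2, h3⟩ := hx
    have hxA : evalAt F ι v x ∈ A k := by
      rw [hA]
      simp only [mem_preimage, mem_prod, h1]
      exact ⟨zero_mem_piPrimePowBall _, h2⟩
    have hps : placeSplitting F ι v (0, ((placeSplitting F ι v).symm x).2) = x - single F ι v (evalAt F ι v x) := by
      rw [placeSplitting_apply, map_zero, zero_add, placeSplitting_symm_apply_snd]
    show 1 ≤ Φ k x
    simp only [hΦ, indicator_of_mem hxA, one_mul, hps]
    exact h3
  exact le_antisymm (ge_of_tendsto' (by simpa only [ENNReal.ofReal_zero] using ENNReal.tendsto_ofReal hE) hbound)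
    bot_le

/-! ## §3 The hyperplane nulls -/

/-- **FIRST COORDINATE HYPERPLANE**: `E_X {x | (β x_v)₁ = 0} = 0` — the frame boxes of §2 exhaust the hyperplane
(`(β x_v)₂` lies in some `(𝔭^{-j})^κ`, `x − single x_v` in some member of a compact exhaustion of `X`, on which a Schwartz–Bruhat
cut-off ★ `exists_piSchwartzBruhatReal_cutoff` is `1`). [cite: Weil1965, Chap. V n° 51, pp. 73–75] -/
theorem adelicSiegelMeasure_frameHyperplane_fst_eq_zero
    (hHaar : ∃ cst : ℝ≥0, 0 < cst ∧ Measure.map βv (Measure.pi fun _ : ι => μv) =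
      (cst : ℝ≥0∞) • ((Measure.pi fun _ : κ => μv).prod (Measure.pi fun _ : κ => μv)))
    (hadd : ∀ (a : ι → v.adicCompletion F) (y : ι → AdeleRing (𝓞 F) F), y ∈ trivialAt F ι v →
      h (single F ι v a + y) = h (single F ι v a) + h y)
    (hloc : ∀ a : ι → v.adicCompletion F, h (single F ι v a) = adeleSingleHom F v ((βv a).1 ⬝ᵥ (βv a).2)) :
    adelicSiegelMeasure F ι νX h hh hB {x | (βv (evalAt F ι v x)).1 = 0} = 0 := by
  classical
  haveI := secondCountableTopology_adeleRing (K := F)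
  haveI := secondCountableTopology_pi F ι
  haveI := locallyCompactSpace_pi F ι
  haveI : SigmaCompactSpace (ι → AdeleRing (𝓞 F) F) := sigmaCompactSpace_of_locallyCompact_secondCountable
  -- Schwartz–Bruhat cut-offs `Ψ_N = 1` on the compact exhaustion `K_N` of `X`
  have hcut : ∀ N : ℕ, ∃ Ψ : (ι → AdeleRing (𝓞 F) F) → ℝ, Ψ ∈ piSchwartzBruhatReal F ι ∧ 0 ≤ Ψ ∧
      ∀ y ∈ compactCovering (ι → AdeleRing (𝓞 F) F) N, Ψ y = 1 := by
    intro N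
    obtain ⟨Ψ, hΨm, -, -, -, h01, h1⟩ := exists_piSchwartzBruhatReal_cutoff (K := F) (ι := ι)
      (isCompact_compactCovering (ι → AdeleRing (𝓞 F) F) N) isOpen_univ (subset_univ _)
    exact ⟨Ψ, hΨm, fun y => (h01 y).1, h1⟩
  choose Ψ hΨm hΨ0 hΨ1 using hcut
  -- the hyperplane is covered by the frame boxes `W(j, Ψ_N)`
  have hcover : {x : ι → AdeleRing (𝓞 F) F | (βv (evalAt F ι v x)).1 = 0} ⊆
      ⋃ j : ℕ, ⋃ N : ℕ, {x | (βv (evalAt F ι v x)).1 = 0 ∧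
        (βv (evalAt F ι v x)).2 ∈ piPrimePowBall (v.adicCompletion F) κ (-(j : ℤ)) ∧
          1 ≤ Ψ N (x - single F ι v (evalAt F ι v x))} := by
    intro x hx
    obtain ⟨j, hj⟩ := exists_mem_piPrimePowBall (βv (evalAt F ι v x)).2
    obtain ⟨N, hN⟩ := exists_mem_compactCovering (x - single F ι v (evalAt F ι v x))
    exact mem_iUnion.2 ⟨j, mem_iUnion.2 ⟨N, hx, hj, (hΨ1 N _ hN).symm.le⟩⟩
  refine measure_mono_null hcover (measure_iUnion_null fun j => measure_iUnion_null fun N => ?_)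
  exact adelicSiegelMeasure_frameBox_eq_zero F ι νX h hh hB v μv βv hHaar hadd hloc (-(j : ℤ)) (hΨm N) (hΨ0 N)

/-- **`E_X` DOES NOT CHARGE THE COORDINATE HYPERPLANES OF A SPLIT FRAME.**  For Weil's Siegel–Eisenstein measure `E_X` of
`(X = 𝔸_F^ι, h)` under condition (B), a finite place `v`, a Haar measure `μ_v` on `F_v` and a linear frame `β : F_v^ι ≃ F_v^κ × F_v^κ` with
`β_* μ_v^ι = c · μ_v^κ ⊗ μ_v^κ` such that `h` splits along the place splitting (`hadd`) and is the split form of the frame at `v`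
(`hloc : h(single a) = ι_v((β a)₁ ⬝ᵥ (β a)₂)`): `E_X {(β x_v)₁ = 0} = 0` and `E_X {(β x_v)₂ = 0} = 0` (the second from the first for the
swapped frame). [cite: Weil1965, Chap. V n° 51, pp. 73–75] [cite: Weil1965, Chap. IV n° 41, (35) p. 59] -/
theorem adelicSiegelMeasure_frameHyperplane_eq_zero
    (hHaar : ∃ cst : ℝ≥0, 0 < cst ∧ Measure.map βv (Measure.pi fun _ : ι => μv) =
      (cst : ℝ≥0∞) • ((Measure.pi fun _ : κ => μv).prod (Measure.pi fun _ : κ => μv)))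
    (hadd : ∀ (a : ι → v.adicCompletion F) (y : ι → AdeleRing (𝓞 F) F), y ∈ trivialAt F ι v →
      h (single F ι v a + y) = h (single F ι v a) + h y)
    (hloc : ∀ a : ι → v.adicCompletion F, h (single F ι v a) = adeleSingleHom F v ((βv a).1 ⬝ᵥ (βv a).2)) :
    adelicSiegelMeasure F ι νX h hh hB {x | (βv (evalAt F ι v x)).1 = 0} = 0 ∧
      adelicSiegelMeasure F ι νX h hh hB {x | (βv (evalAt F ι v x)).2 = 0} = 0 := by
  refine ⟨adelicSiegelMeasure_frameHyperplane_fst_eq_zero F ι νX h hh hB v μv βv hHaar hadd hloc, ?_⟩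
  haveI := secondCountableTopology_adicCompletion F v
  haveI : BorelSpace (κ → v.adicCompletion F) := Pi.borelSpace
  -- the swapped frame `β' = swap ∘ β`
  set β' : (ι → v.adicCompletion F) ≃ₗ[v.adicCompletion F] ((κ → v.adicCompletion F) × (κ → v.adicCompletion F)) :=
    βv.trans (LinearEquiv.prodComm (v.adicCompletion F) _ _) with hβ'
  have hβ'1 : ∀ a, (β' a).1 = (βv a).2 := fun a => rfl
  have hβ'2 : ∀ a, (β' a).2 = (βv a).1 := fun a => rfl
  have hHaar' : ∃ cst : ℝ≥0, 0 < cst ∧ Measure.map β' (Measure.pi fun _ : ι => μv) =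
      (cst : ℝ≥0∞) • ((Measure.pi fun _ : κ => μv).prod (Measure.pi fun _ : κ => μv)) := by
    obtain ⟨cst, hcst, hmap⟩ := hHaar
    refine ⟨cst, hcst, ?_⟩
    have hβm : Measurable βv := by
      haveI : IsModuleTopology (v.adicCompletion F) ((κ → v.adicCompletion F) × (κ → v.adicCompletion F)) :=
        inferInstance
      exact (IsModuleTopology.continuous_of_linearMap βv.toLinearMap).measurable
    have hcoe : (β' : (ι → v.adicCompletion F) → (κ → v.adicCompletion F) × (κ → v.adicCompletion F)) = Prod.swap ∘ βv := rfl
    rw [hcoe, ← Measure.map_map measurable_swap hβm, hmap, Measure.map_smul, Measure.prod_swap]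
  have hloc' : ∀ a : ι → v.adicCompletion F, h (single F ι v a) = adeleSingleHom F v ((β' a).1 ⬝ᵥ (β' a).2) := fun a => by
    rw [hβ'1, hβ'2, dotProduct_comm]; exact hloc a
  have h2 := adelicSiegelMeasure_frameHyperplane_fst_eq_zero F ι νX h hh hB v μv β' hHaar' hadd hloc'
  simpa only [hβ'1] using h2

end Null

end Literature.NumberTheory.Weil1965

end
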